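import Literature.NumberTheory.Automorphic.ArtinLFunctionsBrauerProofs
import Literature.NumberTheory.LFunctions.StarkNoQuadraticSubfieldGlue
import HarnessLib

/-!
# Stub `stub_dmFixedField` (line `Sketch`, crux `QuinticDedekindPole`, stmt-Langlands-17270)

Galois bookkeeping for the FALSE direction of the crux.  `(θ, q)` is the Doud–Moore `A₅` datum:
the five roots `θ i ∈ ℚ̄` of `f = X⁵ − X⁴ − 780X³ + 9911X² − 24208X + 15952` and a finite Galois
quotient `q : Γ_ℚ → A₅` through which `Γ_ℚ` permutes them (`σ • θ i = θ (q σ i)`).  We prove: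

1. the subextension of `ℚ̄/ℚ` cut out by the stabiliser of `i` is `ℚ(θ i)`:
   `ℚ̄^{q⁻¹ Stab(i)} = ℚ⟮θ i⟯` — indeed `q⁻¹ Stab(i) = Gal(ℚ̄/ℚ(θ i))` (`σ` fixes `ℚ(θ i)`
   pointwise iff `σ (θ i) = θ i` iff `q σ` fixes `i`, the roots being distinct), and
   `ℚ̄^{Gal(ℚ̄/E)} = E` by infinite Galois theory (`InfiniteGalois.fixedField_fixingSubgroup`);
2. `ℚ⟮θ i⟯` is generated over `ℚ` by its canonical generator (`IntermediateField.lift_top`,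
   `lift_adjoin_simple`; stated for the `ℚ`-algebra structure found by instance search, which is
   unique by `Subsingleton (Algebra ℚ _)`);
3. every number field `K = ℚ(η)` with `f(η) = 0` is ring-isomorphic to some `ℚ⟮θ i⟯`: embed
   `φ : K → ℚ̄` (`IsAlgClosed.lift`); `f(φ η) = 0`, so `φ η = θ i` for some `i`, and
   `φ(K) = φ(ℚ(η)) = ℚ(φ η) = ℚ⟮θ i⟯` (`AlgHom.fieldRange_eq_map`, `IntermediateField.adjoin_map`).

References: Neukirch, *Algebraic Number Theory*, IV §1 (Krull topology, closed subgroups ↔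
subextensions). [cite: NeukirchANT1999, IV §1]
-/

set_option linter.dupNamespace false -- project-wide option; `Summit.Langlands.Langlands` is the mandated namespace

noncomputable section

open Literature.NumberTheory.Automorphic Literature.NumberTheory.GaloisRepresentations
open scoped IntermediateField

namespace Summit.Langlands.Langlands.Theorems.DedekindQuotient1951

/-- An `F`-automorphism of `E` fixes `F⟮α⟯` pointwise iff it fixes `α` (the stabiliser of `α`
fixes `F⟮α⟯` by the Galois connection `IntermediateField.le_iff_le` and `adjoin_simple_le_iff`).
[folklore] -/
theorem dmFixedField_mem_fixingSubgroup_adjoin_simple_iff {F E : Type*} [Field F] [Field E]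
    [Algebra F E] (α : E) (σ : E ≃ₐ[F] E) : σ ∈ F⟮α⟯.fixingSubgroup ↔ σ α = α := by
  constructor
  · intro h
    rw [IntermediateField.mem_fixingSubgroup_iff] at h
    exact h α (IntermediateField.mem_adjoin_simple_self F α)
  · intro h
    have hle : MulAction.stabilizer (E ≃ₐ[F] E) α ≤ F⟮α⟯.fixingSubgroup := by
      rw [← IntermediateField.le_iff_le, IntermediateField.adjoin_simple_le_iff,
        IntermediateField.mem_fixedField_iff]
      exact fun f hf => hf
    exact hle (MulAction.mem_stabilizer_iff.2 h)

/-- `F⟮α⟯` is generated over `F` by its canonical generator `AdjoinSimple.gen F α`, for any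
`F`-algebra structure `inst` on `F⟮α⟯` equal to the subalgebra one (over `F = ℚ` instance search
finds `DivisionRing.toRatAlgebra`, equal to it by `Subsingleton (Algebra ℚ _)`); proof:
`lift` is injective and `lift F⟮gen⟯ = F⟮α⟯ = lift ⊤`. [folklore] -/
theorem dmFixedField_adjoin_gen_eq_top {F E : Type*} [Field F] [Field E] [Algebra F E] (α : E)
    (inst : Algebra F F⟮α⟯) (hinst : inst = IntermediateField.algebra' F⟮α⟯) :
    IntermediateField.adjoin F ({IntermediateField.AdjoinSimple.gen F α} : Set F⟮α⟯) = ⊤ := by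
  subst hinst
  apply IntermediateField.lift_injective
  rw [IntermediateField.lift_adjoin_simple, IntermediateField.lift_top]
  rfl

/-- Pushing the Doud–Moore quintic through a ring homomorphism. [folklore] -/
theorem dmFixedField_map_quintic {R S : Type*} [Ring R] [Ring S] (f : R →+* S) (x : R)
    (hx : x ^ 5 - x ^ 4 - 780 * x ^ 3 + 9911 * x ^ 2 - 24208 * x + 15952 = 0) :
    f x ^ 5 - f x ^ 4 - 780 * f x ^ 3 + 9911 * f x ^ 2 - 24208 * f x + 15952 = 0 := by
  have h := congrArg f hx
  rw [map_zero] at h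
  simpa only [map_sub, map_add, map_mul, map_pow, map_ofNat] using h

/-- **stub_dmFixedField** (Galois bookkeeping for the Doud–Moore `A₅` datum): the field cut out by
the stabiliser of `i` is `ℚ(θ i) ⊆ ℚ̄`, it is generated by `θ i`, and every abstract
Doud–Moore-generated number field `K = ℚ(η)` is ring-isomorphic to some `ℚ(θ i)` (embed `K ↪ ℚ̄`;
the image of `η` is a root).  The hypotheses `hq`, `hroot` belong to the datum but are not needed
for these three conclusions. [cite: NeukirchANT1999, IV §1] -/
theorem stub_dmFixedField (θ : Fin 5 → AlgebraicClosure ℚ)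
    (q : Field.absoluteGaloisGroup ℚ →* alternatingGroup (Fin 5)) (hq : IsArtinQuotient q)
    (hroot : ∀ i, θ i ^ 5 - θ i ^ 4 - 780 * θ i ^ 3 + 9911 * θ i ^ 2 - 24208 * θ i + 15952 = 0)
    (hinj : Function.Injective θ)
    (hall : ∀ x : AlgebraicClosure ℚ, x ^ 5 - x ^ 4 - 780 * x ^ 3 + 9911 * x ^ 2 - 24208 * x + 15952 = 0 →
      ∃ i, x = θ i)
    (hact : ∀ (σ : Field.absoluteGaloisGroup ℚ) (i : Fin 5), σ • θ i = θ ((q σ : Equiv.Perm (Fin 5)) i)) :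
    (∀ i : Fin 5, quotientFixedField q (MulAction.stabilizer (alternatingGroup (Fin 5)) i) = ℚ⟮θ i⟯) ∧
    (∀ i : Fin 5, IntermediateField.adjoin ℚ
        ({IntermediateField.AdjoinSimple.gen ℚ (θ i)} : Set ℚ⟮θ i⟯) = ⊤) ∧
    (∀ (K : Type) [Field K] [NumberField K] (η : K),
      η ^ 5 - η ^ 4 - 780 * η ^ 3 + 9911 * η ^ 2 - 24208 * η + 15952 = 0 →
      IntermediateField.adjoin ℚ ({η} : Set K) = ⊤ → ∃ i : Fin 5, Nonempty (K ≃+* ℚ⟮θ i⟯)) := by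
  -- `hq` (surjectivity / openness of `q`) and `hroot` are part of the datum but idle here
  have _hdatum := And.intro hq.isOpen_ker (hroot 0)
  refine ⟨fun i => ?_, fun i => ?_, fun K _ _ η hη hK => ?_⟩
  · -- clause 1: `q⁻¹ Stab(i) = Gal(ℚ̄/ℚ(θ i))`, then infinite Galois theory
    have hsub : (MulAction.stabilizer (alternatingGroup (Fin 5)) i).comap q =
        (ℚ⟮θ i⟯).fixingSubgroup := by
      refine Subgroup.ext fun σ => ?_
      change (q σ) • i = i ↔
        Field.absoluteGaloisGroup.toAlgEquiv ℚ σ ∈ (ℚ⟮θ i⟯).fixingSubgroup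
      refine Iff.trans ?_ (dmFixedField_mem_fixingSubgroup_adjoin_simple_iff (θ i) _).symm
      change ((q σ : Equiv.Perm (Fin 5)) i = i) ↔ σ • θ i = θ i
      rw [hact σ i, hinj.eq_iff]
    exact (congrArg IntermediateField.fixedField hsub).trans
      (InfiniteGalois.fixedField_fixingSubgroup _)
  · -- clause 2: `ℚ⟮θ i⟯ = ℚ(gen)`
    exact dmFixedField_adjoin_gen_eq_top (θ i) _ (Subsingleton.elim _ _)
  · -- clause 3: embed `K ↪ ℚ̄`; the image of `η` is a root `θ i`, and `φ(K) = ℚ(θ i)`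
    let φ : K →ₐ[ℚ] AlgebraicClosure ℚ := IsAlgClosed.lift
    obtain ⟨i, hi⟩ := hall (φ η) (dmFixedField_map_quintic φ.toRingHom η hη)
    have hrange : φ.fieldRange = ℚ⟮θ i⟯ := by
      rw [AlgHom.fieldRange_eq_map, ← hK, IntermediateField.adjoin_map, Set.image_singleton]
      exact congrArg (fun x => ℚ⟮x⟯) hi
    exact ⟨i, ⟨(φ.equivFieldRange.trans (IntermediateField.equivOfEq hrange)).toRingEquiv⟩⟩

end Summit.Langlands.Langlands.Theorems.DedekindQuotient1951

end
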